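import Mathlib.RepresentationTheory.Homological.GroupCohomology.LowDegree
import Mathlib.RingTheory.RootsOfUnity.Basic
import Mathlib.Algebra.Group.Submonoid.Operations
import Mathlib.Data.ZMod.Basic
import HarnessLib

/-!
# Frobenioids II, Definition 2.1: the cyclotomic portion `μ_N(A)`, Kummer classes, the Kummer map

Mochizuki, *The geometry of Frobenioids II*, Kyushu J. Math. **62** (2008) 401–460, §2 "The Kummer
and Reciprocity Maps", Definition 2.1 (i), (ii), author's text p. 16
[cite: MochizukiFrdII2008, Def 2.1 p.16] — the most-cited item of [FrdII] in [EtTh] (×8) and the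
source of every "Kummer class" in IUT I–III.

**Setting of the paper.** `C` a Frobenioid, `A ∈ Ob(C)`, `O^×(A) ⊆ O^⊳(A)` the (commutative,
[FrdI] Rmk 1.3.1) monoid of base-identity endomorphisms of `A`, acted on by `Aut_C(A)` through
`Aut_{C/D}(A) := Im(Aut_C(A) → Aut_D(A_D))`; `N ∈ ℕ_{≥1}`. (i) `μ_N(A) ⊆ O^×(A)` is the subgroup of
elements annihilated by `N` (the *cyclotomic portion of order `N`*), stabilized by `Aut_{C/D}(A)`;
`A` is *`μ_N`-saturated* if `μ_N(A) ≅ ℤ/Nℤ`. (ii) For `H_A ⊆ Aut_{C/D}(A)` and `f ∈ O^⊳(A)^{H_A}`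
with an `N`-th root `g`, `H_A` stabilizes `μ_N(A) · g` [the set of `N`-th roots of `f`,
[FrdI] Def. 1.3 (vi)], whence a class `κ_f ∈ H¹(H_A, μ_N(A))` "easily verified to be independent of
the choice of `g`" — the *Kummer class* — and `f ↦ κ_f` is a homomorphism
`O^⊳(A)^{H_A} ∩ O^⊳(A)^N → H¹(H_A, μ_N(A))`, the *Kummer map*.

**What this file does.** The construction uses only: a commutative monoid `O` (= `O^⊳(A)`) with an
action of a group `Γ` (= `Aut_{C/D}(A)`, or `Aut_C(A)`) by monoid automorphisms, a subgroup `H ≤ Γ`,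
and the TORSOR PROPERTY "two `N`-th roots of the same element differ by a unit" together with
cancellativity of `O` (both hold in a Frobenioid by [FrdI] Def. 1.3 (vi); the bridge is stated with
the Frobenioid-level file). In that generality we DEFINE `μ_N`, `μ_N`-saturation, the Kummer cocycle,
the Kummer class in Mathlib's `groupCohomology.H1`, and PROVE the two printed claims: independence of
the root (`kummerClass_eq_of_pow_eq`) and multiplicativity (`kummerClassOfRoot_mul`), and assemble
the Kummer map as a monoid homomorphism `kummerMap`. Universe: Mathlib's multiplicative-cocycle API
for `Rep ℤ H` is stated in `Type`, so `Γ`, `O` live in `Type`.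
Deliberately NOT here: "`H_A` acts trivially on `H¹(H_A, μ_N(A))`" (inner action on cohomology;
a remark, not used later in the file), Definitions 2.2–2.3 and Theorem 2.4 (they need the `p`-adic
Frobenioid and local class field theory: companion file).
-/

namespace Literature.AlgebraicGeometry.Frobenioids

open groupCohomology

namespace Kummer

variable {Γ : Type} [Group Γ] (N : ℕ) {O : Type} [CommMonoid O] [MulDistribMulAction Γ O]

/-! ### The action on units and the cyclotomic portion `μ_N` (Def. 2.1 (i)) -/

/-- The action of `γ ∈ Γ` on the units `O^× = Oˣ` induced by its action on the monoid `O`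
(the "natural action of `Aut_C(A)` on `O^×(A)`", FrdII Def. 2.1 (i), p. 16).
[cite: MochizukiFrdII2008, Def 2.1 (i) p.16] -/
def unitsAct (γ : Γ) : Oˣ →* Oˣ := Units.map (MulDistribMulAction.toMonoidHom O γ)

/-- The action on units, on underlying elements. [cite: MochizukiFrdII2008, Def 2.1 (i) p.16] -/
@[simp] theorem coe_unitsAct (γ : Γ) (u : Oˣ) : (unitsAct γ u : O) = γ • (u : O) := rfl

/-- `1` acts trivially on units. [cite: MochizukiFrdII2008, Def 2.1 (i) p.16] -/
theorem unitsAct_one (u : Oˣ) : unitsAct (1 : Γ) u = u := Units.ext (one_smul Γ (u : O))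

/-- The action on units is multiplicative in `γ`. [cite: MochizukiFrdII2008, Def 2.1 (i) p.16] -/
theorem unitsAct_mul (γ δ : Γ) (u : Oˣ) : unitsAct (γ * δ) u = unitsAct γ (unitsAct δ u) :=
  Units.ext (mul_smul γ δ (u : O))

variable (O)

/-- **Definition 2.1 (i)** (FrdII p. 16): `μ_N(A) ⊆ O^×(A)`, "the subgroup of elements of `O^×(A)`
that are annihilated by `N`" — the *cyclotomic portion of `O^×(A)` of order `N`*; Mathlib's
`rootsOfUnity N O`. [cite: MochizukiFrdII2008, Def 2.1 (i) p.16] -/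
abbrev cyclotomicPortion : Subgroup Oˣ := rootsOfUnity N O

/-- `μ_N` as a type (it carries the induced `Γ`-action, `Mu.instMulDistribMulAction`).
[cite: MochizukiFrdII2008, Def 2.1 (i) p.16] -/
def Mu : Type := ↥(rootsOfUnity N O)

/-- `μ_N` is a commutative group. [cite: MochizukiFrdII2008, Def 2.1 (i) p.16] -/
instance Mu.instCommGroup : CommGroup (Mu N O) := inferInstanceAs (CommGroup ↥(rootsOfUnity N O))

variable {N O}

/-- An element of `μ_N` from a unit killed by `N`. [cite: MochizukiFrdII2008, Def 2.1 (i) p.16] -/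
def Mu.mk (u : Oˣ) (hu : u ∈ rootsOfUnity N O) : Mu N O := show ↥(rootsOfUnity N O) from ⟨u, hu⟩

/-- The underlying unit of an element of `μ_N`. [cite: MochizukiFrdII2008, Def 2.1 (i) p.16] -/
def Mu.val (ζ : Mu N O) : Oˣ := (show ↥(rootsOfUnity N O) from ζ).1

/-- Elements of `μ_N` are killed by `N`. [cite: MochizukiFrdII2008, Def 2.1 (i) p.16] -/
theorem Mu.val_mem (ζ : Mu N O) : ζ.val ∈ rootsOfUnity N O := (show ↥(rootsOfUnity N O) from ζ).2

/-- Elements of `μ_N` are determined by their underlying unit. [cite: MochizukiFrdII2008, Def 2.1 (i) p.16] -/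
@[ext] theorem Mu.ext {ζ ξ : Mu N O} (h : ζ.val = ξ.val) : ζ = ξ := Subtype.ext h

/-- `Mu.val` of `Mu.mk`. [cite: MochizukiFrdII2008, Def 2.1 (i) p.16] -/
@[simp] theorem Mu.val_mk (u : Oˣ) (hu : u ∈ rootsOfUnity N O) : (Mu.mk u hu).val = u := rfl

/-- `Mu.val` is multiplicative. [cite: MochizukiFrdII2008, Def 2.1 (i) p.16] -/
@[simp] theorem Mu.val_mul (ζ ξ : Mu N O) : (ζ * ξ).val = ζ.val * ξ.val := rfl

/-- `Mu.val 1 = 1`. [cite: MochizukiFrdII2008, Def 2.1 (i) p.16] -/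
@[simp] theorem Mu.val_one : (1 : Mu N O).val = 1 := rfl

/-- `Mu.val` of an inverse. [cite: MochizukiFrdII2008, Def 2.1 (i) p.16] -/
@[simp] theorem Mu.val_inv (ζ : Mu N O) : ζ⁻¹.val = ζ.val⁻¹ := rfl

/-- "The submonoid `μ_N(A) ⊆ O^×(A) ⊆ O^⊳(A)` is stabilized by the natural action of `Aut_{C/D}(A)` on
`O^⊳(A)`" (FrdII Def. 2.1 (i), p. 16). [cite: MochizukiFrdII2008, Def 2.1 (i) p.16] -/
theorem unitsAct_mem_rootsOfUnity (γ : Γ) {u : Oˣ} (hu : u ∈ rootsOfUnity N O) :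
    unitsAct γ u ∈ rootsOfUnity N O := by
  rw [mem_rootsOfUnity] at hu ⊢
  rw [← map_pow, hu, map_one]

/-- The induced action of `Γ` on `μ_N` by group automorphisms (FrdII Def. 2.1 (i), p. 16).
[cite: MochizukiFrdII2008, Def 2.1 (i) p.16] -/
instance Mu.instMulDistribMulAction : MulDistribMulAction Γ (Mu N O) where
  smul γ ζ := Mu.mk (unitsAct γ ζ.val) (unitsAct_mem_rootsOfUnity γ ζ.val_mem)
  one_smul ζ := Mu.ext (by change unitsAct (1 : Γ) ζ.val = ζ.val; exact unitsAct_one ζ.val)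
  mul_smul γ δ ζ := Mu.ext (by
    change unitsAct (γ * δ) ζ.val = unitsAct γ (unitsAct δ ζ.val); exact unitsAct_mul γ δ ζ.val)
  smul_mul γ ζ ξ := Mu.ext (by
    change unitsAct γ (ζ * ξ).val = unitsAct γ ζ.val * unitsAct γ ξ.val
    rw [Mu.val_mul, map_mul])
  smul_one γ := Mu.ext (by change unitsAct γ (1 : Mu N O).val = 1; rw [Mu.val_one, map_one])

/-- The action on `μ_N`, on underlying units. [cite: MochizukiFrdII2008, Def 2.1 (i) p.16] -/
@[simp] theorem Mu.val_smul (γ : Γ) (ζ : Mu N O) : (γ • ζ).val = unitsAct γ ζ.val := rfl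

variable (N O)

/-- **Definition 2.1 (i)** (FrdII p. 16): `A` is *`μ_N`-saturated* "if the abstract group `μ_N(A)` is
isomorphic to `ℤ/Nℤ`." [cite: MochizukiFrdII2008, Def 2.1 (i) p.16] -/
@[mk_iff] structure IsMuSaturated : Prop where
  /-- an isomorphism `μ_N ≅ ℤ/Nℤ` of abstract groups exists -/
  nonempty_mulEquiv : Nonempty (Mu N O ≃* Multiplicative (ZMod N))

/-- The torsor property of `N`-th roots used in Def. 2.1 (ii): two `N`-th roots of the same element
differ by a unit ("`H_A` stabilizes the subset `μ_N(A) · g ⊆ O^⊳(A)` [i.e., the subset of `N`-th roots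
of `f` — cf. [FrdI], Definition 1.3, (vi)]", FrdII p. 16). In a Frobenioid this is [FrdI] Def. 1.3
(vi) "faithfulness up to units"; here it is the hypothesis under which the Kummer class is defined.
[cite: MochizukiFrdII2008, Def 2.1 (ii) p.16] -/
@[mk_iff] structure NthRootsDifferByUnits : Prop where
  /-- two `N`-th roots of the same element differ by a unit -/
  exists_unit : ∀ g g' : O, g' ^ N = g ^ N → ∃ u : Oˣ, g' = u * g

variable {N O}

/-! ### The Kummer cocycle and class (Def. 2.1 (ii)) -/

section Cocycle

variable [IsCancelMul O] (hO : NthRootsDifferByUnits N O) (H : Subgroup Γ)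

include hO

/-- For `f` fixed by `h` and an `N`-th root `g` of `f`, `h • g` is again an `N`-th root of `f`, hence
`h • g = ζ · g` for a UNIQUE `ζ ∈ μ_N` (FrdII Def. 2.1 (ii), p. 16: "`H_A` stabilizes the subset
`μ_N(A) · g`"). [cite: MochizukiFrdII2008, Def 2.1 (ii) p.16] -/
theorem existsUnique_smul_root_eq {f g : O} (hg : g ^ N = f) {h : Γ} (hf : h • f = f) :
    ∃! ζ : Mu N O, h • g = (ζ.val : O) * g := by
  have hroot : (h • g) ^ N = g ^ N := by rw [← smul_pow', hg, hf]
  obtain ⟨u, hu⟩ := hO.exists_unit g (h • g) hroot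
  have huN : u ∈ rootsOfUnity N O := by
    rw [mem_rootsOfUnity', ← mul_left_inj (g ^ N) ]
    · rw [one_mul, ← mul_pow, ← hu, hroot]
  refine ⟨Mu.mk u huN, by simpa using hu, fun ζ hζ => Mu.ext (Units.ext ?_)⟩
  rw [Mu.val_mk]
  exact mul_right_cancel (hζ.symm.trans hu)

/-- The Kummer cocycle of the root `g` of the `H`-invariant element `f`: `h ↦` the unique `ζ_h ∈ μ_N`
with `h • g = ζ_h · g` (FrdII Def. 2.1 (ii), p. 16). [cite: MochizukiFrdII2008, Def 2.1 (ii) p.16] -/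
noncomputable def kummerCocycle {f g : O} (hg : g ^ N = f) (hf : ∀ h : H, (h : Γ) • f = f) :
    H → Mu N O :=
  fun h => (existsUnique_smul_root_eq hO hg (hf h)).choose

/-- The defining equation of the Kummer cocycle: `h • g = ζ_h · g`.
[cite: MochizukiFrdII2008, Def 2.1 (ii) p.16] -/
theorem smul_root_eq {f g : O} (hg : g ^ N = f) (hf : ∀ h : H, (h : Γ) • f = f) (h : H) :
    (h : Γ) • g = ((kummerCocycle hO H hg hf h).val : O) * g :=
  (existsUnique_smul_root_eq hO hg (hf h)).choose_spec.1

/-- Uniqueness: any `ζ ∈ μ_N` with `h • g = ζ · g` is the value of the Kummer cocycle at `h`.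
[cite: MochizukiFrdII2008, Def 2.1 (ii) p.16] -/
theorem kummerCocycle_eq_of_smul_eq {f g : O} (hg : g ^ N = f) (hf : ∀ h : H, (h : Γ) • f = f)
    (h : H) {ζ : Mu N O} (hζ : (h : Γ) • g = (ζ.val : O) * g) : kummerCocycle hO H hg hf h = ζ :=
  ((existsUnique_smul_root_eq hO hg (hf h)).unique (smul_root_eq hO H hg hf h) hζ)

/-- The Kummer cocycle IS a (multiplicative) 1-cocycle of `H` with values in the `H`-module `μ_N`:
`ζ_{hk} = (h • ζ_k) · ζ_h` (FrdII Def. 2.1 (ii), p. 16: "hence determines a cohomology class").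
[cite: MochizukiFrdII2008, Def 2.1 (ii) p.16] -/
theorem isMulCocycle₁_kummerCocycle {f g : O} (hg : g ^ N = f) (hf : ∀ h : H, (h : Γ) • f = f) :
    IsMulCocycle₁ (kummerCocycle hO H hg hf) := by
  intro h k
  apply kummerCocycle_eq_of_smul_eq
  rw [Subgroup.coe_mul, mul_smul, smul_root_eq hO H hg hf k, MulDistribMulAction.smul_mul,
    smul_root_eq hO H hg hf h, ← mul_assoc]
  congr 1

/-- **Definition 2.1 (ii)**, the *Kummer class* `κ_f ∈ H¹(H_A, μ_N(A))` of the `H`-invariant `f`,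
computed from the root `g` (FrdII p. 16). [cite: MochizukiFrdII2008, Def 2.1 (ii) p.16] -/
noncomputable def kummerClassOfRoot {f g : O} (hg : g ^ N = f) (hf : ∀ h : H, (h : Γ) • f = f) :
    H1 (Rep.ofMulDistribMulAction H (Mu N O)) :=
  H1π _ (cocyclesOfIsMulCocycle₁ (isMulCocycle₁_kummerCocycle hO H hg hf))

/-- "`κ_f` … is easily verified to be independent of the choice of `g`" (FrdII Def. 2.1 (ii), p. 16):
two `N`-th roots `g₁`, `g₂ = ζ₀ g₁` of `f` give cocycles differing by the coboundary of `ζ₀`.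
[cite: MochizukiFrdII2008, Def 2.1 (ii) p.16] -/
theorem kummerClass_eq_of_pow_eq {f g₁ g₂ : O} (hg₁ : g₁ ^ N = f) (hg₂ : g₂ ^ N = f)
    (hf : ∀ h : H, (h : Γ) • f = f) :
    kummerClassOfRoot hO H hg₁ hf = kummerClassOfRoot hO H hg₂ hf := by
  -- `g₂ = u · g₁` with `u ∈ μ_N` by the torsor property and cancellation
  obtain ⟨u, hu⟩ := hO.exists_unit g₁ g₂ (hg₂.trans hg₁.symm)
  have huN : u ∈ rootsOfUnity N O := by
    rw [mem_rootsOfUnity', ← mul_left_inj (g₁ ^ N), one_mul, ← mul_pow, ← hu, hg₂, hg₁]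
  let ξ : Mu N O := Mu.mk u huN
  -- the two cocycles differ by the coboundary of `ξ⁻¹`
  have hξ : ξ.val = u := rfl
  -- compute the cocycle of `g₂` in terms of that of `g₁`
  have key : ∀ h : H,
      kummerCocycle hO H hg₂ hf h = kummerCocycle hO H hg₁ hf h * ((h : Γ) • ξ * ξ⁻¹) := by
    intro h
    apply kummerCocycle_eq_of_smul_eq
    rw [hu, MulDistribMulAction.smul_mul, smul_root_eq hO H hg₁ hf h]
    simp only [Mu.val_mul, Mu.val_inv, Units.val_mul, Mu.val_smul, coe_unitsAct, hξ]
    -- goal: `h•u * (ζ * g₁) = ζ * (h•u * ↑u⁻¹) * (↑u * g₁)`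
    rw [mul_assoc ((kummerCocycle hO H hg₁ hf h).val : O), mul_assoc ((h : Γ) • (u : O)),
      ← mul_assoc ((u⁻¹ : Oˣ) : O) (u : O) g₁, Units.inv_mul, one_mul, mul_left_comm]
  rw [kummerClassOfRoot, kummerClassOfRoot, H1π_eq_iff]
  refine ⟨Additive.ofMul (ξ⁻¹ : Mu N O), funext fun h => ?_⟩
  rw [d₀₁_hom_apply, Pi.sub_apply]
  change Additive.ofMul ((h : Γ) • ξ⁻¹ : Mu N O) - Additive.ofMul (ξ⁻¹ : Mu N O) =
    Additive.ofMul (kummerCocycle hO H hg₁ hf h) - Additive.ofMul (kummerCocycle hO H hg₂ hf h)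
  rw [key h, smul_inv', ofMul_mul, ofMul_mul, ofMul_inv, ofMul_inv]
  abel

/-! ### The Kummer map (Def. 2.1 (ii)) -/

/-- The Kummer cocycle of the root `1` of `1` is trivial. [cite: MochizukiFrdII2008, Def 2.1 (ii) p.16] -/
theorem kummerCocycle_one (hg : (1 : O) ^ N = 1) (hf : ∀ h : H, (h : Γ) • (1 : O) = 1) (h : H) :
    kummerCocycle hO H hg hf h = 1 :=
  kummerCocycle_eq_of_smul_eq hO H hg hf h (by rw [smul_one, Mu.val_one, Units.val_one, one_mul])

/-- The Kummer class of `1` (computed from the root `1`) vanishes.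
[cite: MochizukiFrdII2008, Def 2.1 (ii) p.16] -/
theorem kummerClassOfRoot_one (hg : (1 : O) ^ N = 1) (hf : ∀ h : H, (h : Γ) • (1 : O) = 1) :
    kummerClassOfRoot hO H hg hf = 0 := by
  have : cocyclesOfIsMulCocycle₁ (isMulCocycle₁_kummerCocycle hO H hg hf) = 0 :=
    cocycles₁_ext fun h => by
      change Additive.ofMul (kummerCocycle hO H hg hf h) = 0
      rw [kummerCocycle_one, ofMul_one]
  rw [kummerClassOfRoot, this, map_zero]

/-- The Kummer cocycle of a product of roots is the product of the Kummer cocycles.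
[cite: MochizukiFrdII2008, Def 2.1 (ii) p.16] -/
theorem kummerCocycle_mul {f₁ g₁ f₂ g₂ : O} (hg₁ : g₁ ^ N = f₁) (hf₁ : ∀ h : H, (h : Γ) • f₁ = f₁)
    (hg₂ : g₂ ^ N = f₂) (hf₂ : ∀ h : H, (h : Γ) • f₂ = f₂) (hg : (g₁ * g₂) ^ N = f₁ * f₂)
    (hf : ∀ h : H, (h : Γ) • (f₁ * f₂) = f₁ * f₂) (h : H) :
    kummerCocycle hO H hg hf h = kummerCocycle hO H hg₁ hf₁ h * kummerCocycle hO H hg₂ hf₂ h :=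
  kummerCocycle_eq_of_smul_eq hO H hg hf h (by
    rw [MulDistribMulAction.smul_mul, smul_root_eq hO H hg₁ hf₁ h, smul_root_eq hO H hg₂ hf₂ h,
      Mu.val_mul, Units.val_mul, mul_mul_mul_comm])

/-- "The assignment `f ↦ κ_f` determines a homomorphism" (FrdII Def. 2.1 (ii), p. 16): the Kummer
class of a product, computed from the product of roots, is the sum of the Kummer classes.
[cite: MochizukiFrdII2008, Def 2.1 (ii) p.16] -/
theorem kummerClassOfRoot_mul {f₁ g₁ f₂ g₂ : O} (hg₁ : g₁ ^ N = f₁) (hf₁ : ∀ h : H, (h : Γ) • f₁ = f₁)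
    (hg₂ : g₂ ^ N = f₂) (hf₂ : ∀ h : H, (h : Γ) • f₂ = f₂) (hg : (g₁ * g₂) ^ N = f₁ * f₂)
    (hf : ∀ h : H, (h : Γ) • (f₁ * f₂) = f₁ * f₂) :
    kummerClassOfRoot hO H hg hf = kummerClassOfRoot hO H hg₁ hf₁ + kummerClassOfRoot hO H hg₂ hf₂ := by
  have : cocyclesOfIsMulCocycle₁ (isMulCocycle₁_kummerCocycle hO H hg hf) =
      cocyclesOfIsMulCocycle₁ (isMulCocycle₁_kummerCocycle hO H hg₁ hf₁) +
        cocyclesOfIsMulCocycle₁ (isMulCocycle₁_kummerCocycle hO H hg₂ hf₂) :=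
    cocycles₁_ext fun h => by
      change Additive.ofMul (kummerCocycle hO H hg hf h) =
        Additive.ofMul (kummerCocycle hO H hg₁ hf₁ h) + Additive.ofMul (kummerCocycle hO H hg₂ hf₂ h)
      rw [kummerCocycle_mul hO H hg₁ hf₁ hg₂ hf₂ hg hf, ofMul_mul]
  rw [kummerClassOfRoot, this, map_add, kummerClassOfRoot, kummerClassOfRoot]

omit [IsCancelMul O] hO in
variable (N O) in
/-- The domain of the Kummer map: `O^⊳(A)^{H_A} ∩ O^⊳(A)^N`, the `H`-invariant elements admitting an
`N`-th root (FrdII Def. 2.1 (ii), p. 16). [cite: MochizukiFrdII2008, Def 2.1 (ii) p.16] -/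
def kummerDomain : Submonoid O where
  carrier := {f | (∀ h : H, (h : Γ) • f = f) ∧ ∃ g : O, g ^ N = f}
  mul_mem' := by
    rintro a b ⟨ha, ga, hga⟩ ⟨hb, gb, hgb⟩
    exact ⟨fun h => by rw [MulDistribMulAction.smul_mul, ha, hb], ga * gb, by rw [mul_pow, hga, hgb]⟩
  one_mem' := ⟨fun h => smul_one _, 1, one_pow N⟩

/-- **Definition 2.1 (ii)**, the *Kummer class* `κ_f` of `f ∈ O^⊳(A)^{H_A} ∩ O^⊳(A)^N` (any root gives
the same class, `kummerClass_eq_of_pow_eq`). [cite: MochizukiFrdII2008, Def 2.1 (ii) p.16] -/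
noncomputable def kummerClass (f : kummerDomain N O H) : H1 (Rep.ofMulDistribMulAction H (Mu N O)) :=
  kummerClassOfRoot hO H f.2.2.choose_spec f.2.1

/-- The Kummer class of `f` may be computed from ANY `N`-th root of `f`.
[cite: MochizukiFrdII2008, Def 2.1 (ii) p.16] -/
theorem kummerClass_eq (f : kummerDomain N O H) {g : O} (hg : g ^ N = (f : O)) :
    kummerClass hO H f = kummerClassOfRoot hO H hg f.2.1 :=
  kummerClass_eq_of_pow_eq hO H _ _ _

/-- **Definition 2.1 (ii)**, the *Kummer map* (FrdII p. 16): "the assignment `f ↦ κ_f` determines a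
homomorphism `(O^⊳(A) ⊇) O^⊳(A)^{H_A} ∩ O^⊳(A)^N → H¹(H_A, μ_N(A))`" (written into the
multiplicative copy of the additive group `H¹`). [cite: MochizukiFrdII2008, Def 2.1 (ii) p.16] -/
noncomputable def kummerMap :
    kummerDomain N O H →* Multiplicative (H1 (Rep.ofMulDistribMulAction H (Mu N O))) where
  toFun f := Multiplicative.ofAdd (kummerClass hO H f)
  map_one' := by
    rw [kummerClass_eq hO H 1 (g := 1) (by rw [one_pow]; rfl), kummerClassOfRoot_one, ofAdd_zero]
  map_mul' f₁ f₂ := by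
    obtain ⟨g₁, hg₁⟩ := f₁.2.2
    obtain ⟨g₂, hg₂⟩ := f₂.2.2
    rw [← ofAdd_add, kummerClass_eq hO H f₁ hg₁, kummerClass_eq hO H f₂ hg₂,
      kummerClass_eq hO H (f₁ * f₂) (g := g₁ * g₂) (by rw [mul_pow, hg₁, hg₂]; rfl),
      kummerClassOfRoot_mul hO H hg₁ f₁.2.1 hg₂ f₂.2.1]

/-- The Kummer map sends `f` to (the multiplicative copy of) its Kummer class.
[cite: MochizukiFrdII2008, Def 2.1 (ii) p.16] -/
theorem kummerMap_apply (f : kummerDomain N O H) :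
    kummerMap hO H f = Multiplicative.ofAdd (kummerClass hO H f) := rfl

end Cocycle

end Kummer

end Literature.AlgebraicGeometry.Frobenioids
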